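/-
Copyright (c) 2026 the pub-hodgecm-mathlib formalisation cell (harness21).  Prover seat hodgecm-mathlib-K2E4-p10 (g6), Track B ∕ K2-LIT, h413 =
`stmt-HodgeConjecture-24833`, line `K2_E1_TraceFormulaBeta`, campaign «EIS-R7-BL-SPH-3», the `hcusp` DOOR of ★ p859418 (`…ResidueConstantCMThreeOfLetters.hres_cm_three_of_letters`):
«an `L²` class with vanishing constant terms is cuspidal» in the pseudo-Eisenstein currency of ★ density (dealer K2E1-plan (g6) (82), 2026-09-04T10:37:07Z).
-/
import Summits.HodgeConjecture.HodgeConjecture.Theorems.K2E1PseudoEisensteinDensityU   -- ★ (K2E1-p09 g4): the `U(Φ₃)` discharge of the radical data; brings ★ F2a adjunction, ★ F2b, ★ F3-c∕(H2)-f `…_of_cocompact`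
import HarnessLib

/-!
# K2·E1 — `K2E1ContinuedZeroConstantTermOrthogonalCMThree`: AN `L²` CLASS ON `U(Φ₃)(L⁺)∖U(Φ₃)(𝔸_{L⁺})` WHOSE CONSTANT TERMS ALONG THE HEISENBERG RADICAL VANISH ALMOST
# EVERYWHERE IS ORTHOGONAL TO EVERY SQUARE-INTEGRABLE PSEUDO-EISENSTEIN SERIES, HENCE CUSPIDAL — the `hcusp` door of the residue-is-constant payer ★ p859418, every rank + CM print

Track B ∕ K2-LIT, crux h413 = `stmt-HodgeConjecture-24833`, route of record `HCCMUnconditional`; cell `hodgecm-mathlib`, squad K2, ENGINE E1, campaign EIS-R7-BL-SPH-3 (R31).  Prover seat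
`hodgecm-mathlib-K2E4-p10` (g6); DEAL (82) of the dealer K2E1-plan (g6).  THEOREMS ONLY (no `def`, no `instance`, no notation, no named-fact hypothesis, no `sorry`); lane
`--supports stmt-HodgeConjecture-24833 --as helper` (count-neutral).  Closes no socket.  §1 is generic (any adelic group datum with `A_G = 1`, any radical data); §2 is the `U(Φ₃)` print.

THE MATHEMATICS ([MoeglinWaldspurger1995, II.1.2–II.1.4]; [Garrett2018, §1.8]; [BorelJacquet1979, §4.4–§4.6]).  For a Borel right-`N(𝔸)`-invariant `Φ` on `G(𝔸)` with square-integrable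
pseudo-Eisenstein series `θ_Φ(x) = Σ_{q ∈ G(K)∕(G(K) ∩ N)} Φ(x̃ q̃)` and a Borel `ψ` on `X = G(𝔸)∕G(K)` with `∫ θ_{‖Φ‖}‖ψ‖ < ∞`, the unfolding ★ F2a
`adelic_integrable_and_integral_pseudoEisenstein_mul_eq` reads `c_N·∫_X θ_Φ·ψ dμ = c_Γ·∫_{G(𝔸)∕N(𝔸)} Φ(ỹ)·(∫_𝓕 ψ([ỹu⁻¹]) dν_N(u)) dμ_N(ỹ)` — the inner integral is the CONSTANT TERM of
`ψ` at `ỹ`.  Hence: if the constant terms of `ψ` vanish for `μ_N`-almost every `ỹ`, then `∫_X θ_Φ·conj ψ dμ = 0` (§1, `c_N ≠ 0`); for an `L²` class `v` (Hölder against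
`∫ θ_{‖Φ‖}² < ∞`, ★ `lintegral_tsum_enorm_mul_enorm_lt_top`) this is `⟪[θ_Φ], v⟫ = 0` for every `Φ` in the square-integrable test class of EVERY radical — and then `v` is CUSPIDAL by the
density of these classes in `(L²_cusp)ᗮ` (★ (H2)-f `mem_cuspidalSubspace_of_forall_inner_pseudoEisenstein_eq_zero_of_cocompact`).  This is the door through which the residue class
`Res − φ₀r·𝟙` of the continued Eisenstein series (whose constant term vanishes by the continued constant-term identity (E3′)) enters `L²_cusp` in ★ p859418.
* §1 (generic) **`integral_pseudoEisenstein_mul_conj_eq_zero_of_ae_setIntegral_eq_zero`**, **`inner_toLp_pseudoEisenstein_eq_zero_of_ae_setIntegral_eq_zero`**,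
  **`mem_cuspidalSubspace_of_ae_setIntegral_eq_zero`** (all radicals; explicit radical data `μ_N, ν_N, 𝓕` as ★ (H2)-f).
* §2 (`U(Φ₃)`, `𝔓 = cmParabolicDataR L 3`, every datum discharged as in ★ `cmCuspidalSubspaceR_orthogonal_eq_topologicalClosure_span_three`) **`mem_cmCuspidalSubspaceR_three_of_ae_constantTerm_eq_zero`**:
  `v ∈ L²_cusp(U(Φ₃))` for every `L²` class `v` whose constant terms along the Heisenberg radical vanish `μ_N`-a.e., for every Haar `ν_N`, fundamental domain `𝓕` and invariant `μ_N`
  (the trunk's «for all data» convention of ★ `ConstantTermVanishes`, in a.e. form).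
HONEST LABEL: HC_CM is proved only modulo the 7 printed citations (2 remaining named inputs: hLiu418 = `stmt-HodgeConjecture-24832`, h413 = `stmt-HodgeConjecture-24833`) until rung 0
closes; this file asserts no named fact and closes no socket.
References: [MoeglinWaldspurger1995] II.1.2–II.1.4 · [Garrett2018] §1.8 · [BorelJacquet1979] §4.4–§4.6.
-/

set_option autoImplicit false
-- the mandated namespace repeats the single-problem summit's segment (`HodgeConjecture.HodgeConjecture`)
set_option linter.dupNamespace false

noncomputable section

open MeasureTheory Measure Set Filter Topology NumberField
open scoped ENNReal NNReal Pointwise InnerProductSpace ComplexConjugate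
open Literature.MeasureTheory.Group Literature.NumberTheory.Automorphic Literature.NumberTheory.Automorphic.UnitaryGroup AdelicGroupData
open Summit.HodgeConjecture.HodgeConjecture.Cruxes.H413.K2E1CuspidalSpectrumUnitary
open Summit.HodgeConjecture.HodgeConjecture.Cruxes.H413.K2E1PseudoEisensteinUnfolding (unfoldingConstant_pos_of_ne_zero)
open Summit.HodgeConjecture.HodgeConjecture.Cruxes.H413.K2E1PseudoEisensteinCuspOrthogonal
  (adelic_integrable_and_integral_pseudoEisenstein_mul_eq lintegral_tsum_enorm_mul_enorm_lt_top memLp_two_pseudoEisenstein_automorphicQuotient)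
open Summit.HodgeConjecture.HodgeConjecture.Cruxes.H413.K2E1PseudoEisensteinCuspidalCriterionL2 (mem_cuspidalSubspace_of_forall_inner_pseudoEisenstein_eq_zero_of_cocompact)
open Summit.HodgeConjecture.HodgeConjecture.Cruxes.H413.K2E1HeisenbergRadicalCocompactU3 (exists_isCompact_rational_smul_mem_heisenberg)
open Summit.HodgeConjecture.HodgeConjecture.Cruxes.H413.K2E1BorelLeviU (isClosed_cmParabolicDataR_radical_three)
open Summit.HodgeConjecture.HodgeConjecture.Cruxes.H413.K2E1BorelLeviUDomains (exists_isFundamentalDomain_cmParabolicDataR_three)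
open Summit.HodgeConjecture.HodgeConjecture.Cruxes.H413.K2E1PseudoEisensteinDischargeU

namespace Summit.HodgeConjecture.HodgeConjecture.Cruxes.H413.K2E1ContinuedZeroConstantTermOrthogonalCMThree

/-! ## §1 Generic: vanishing constant terms a.e. ⟹ `⟪[θ_Φ], v⟫ = 0` ⟹ `v ∈ L²_cusp` -/

section Adelic

variable {K : Type} [Field K] [NumberField K] (𝒢 : AdelicGroupData K)
  [MeasurableSpace 𝒢.Adelic] [BorelSpace 𝒢.Adelic] [LocallyCompactSpace 𝒢.Adelic] [SecondCountableTopology 𝒢.Adelic] [T2Space 𝒢.Adelic]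
  [DiscreteTopology 𝒢.quotientSubgroup] (hQ : 𝒢.quotientSubgroup = 𝒢.arithmeticSubgroup)
  (𝔓 : 𝒢.ParabolicUnipotentData) (i : 𝔓.ι) [hN : IsClosed ((𝔓.radical i : Subgroup 𝒢.Adelic) : Set 𝒢.Adelic)]
  (μ : Measure 𝒢.automorphicQuotient) [𝒢.IsAutomorphicMeasure μ]
  [MeasurableSpace (𝒢.Adelic ⧸ 𝔓.radical i)] [BorelSpace (𝒢.Adelic ⧸ 𝔓.radical i)]
  (μN : Measure (𝒢.Adelic ⧸ 𝔓.radical i)) [SMulInvariantMeasure 𝒢.Adelic (𝒢.Adelic ⧸ 𝔓.radical i) μN] [IsFiniteMeasureOnCompacts μN]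
  (νN : Measure (𝔓.radical i)) [IsHaarMeasure νN] [SFinite νN] [νN.IsInvInvariant]

include hQ in
/-- **ZERO CONSTANT TERM (a.e.) ⟹ `∫_X θ_Φ·conj ψ dμ = 0`**: for `ψ` Borel on `X` with finite pairing `∫⁻ θ_{‖Φ‖}‖ψ‖ dμ < ∞`, if `∫_𝓕 ψ([ỹ u⁻¹]) dν_N(u) = 0` for `μ_N`-a.e. `ỹ ∈ G(𝔸)∕N(𝔸)`
(`μ_N ≠ 0` invariant), then `θ_Φ ⊥ ψ` — ★ F2a adjunction with `conj ψ`, whose constant terms are the conjugates. [cite: MoeglinWaldspurger1995, II.1.3] [cite: Garrett2018, §1.8] -/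
theorem integral_pseudoEisenstein_mul_conj_eq_zero_of_ae_setIntegral_eq_zero {Φ : 𝒢.Adelic → ℂ} (hΦm : Measurable Φ)
    (hΦ : ∀ (g : 𝒢.Adelic) (n : 𝔓.radical i), Φ (g * n) = Φ g) {ψ : 𝒢.automorphicQuotient → ℂ} (hψm : Measurable ψ)
    {𝓕 : Set (𝔓.radical i)} (h𝓕 : IsFundamentalDomain (𝔓.rational i) 𝓕 νN) (hμN : μN ≠ 0)
    (hfin : ∫⁻ x, (∑' q : 𝒢.quotientSubgroup ⧸ (𝔓.radical i).subgroupOf 𝒢.quotientSubgroup,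
        ‖Φ ((Quotient.out x : 𝒢.Adelic) * ((q.out : 𝒢.quotientSubgroup) : 𝒢.Adelic))‖ₑ) * ‖ψ x‖ₑ ∂μ < ∞)
    (hCT : ∀ᵐ y ∂μN, ∫ u in 𝓕, ψ (𝒢.toAutomorphicQuotient (y.out * (u : 𝒢.Adelic)⁻¹)) ∂νN = 0) :
    ∫ x, (∑' q : 𝒢.quotientSubgroup ⧸ (𝔓.radical i).subgroupOf 𝒢.quotientSubgroup,
        Φ ((Quotient.out x : 𝒢.Adelic) * ((q.out : 𝒢.quotientSubgroup) : 𝒢.Adelic))) * conj (ψ x) ∂μ = 0 := by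
  letI := AdelicGroupData.measurableSpaceQuotientForm 𝒢
  haveI := AdelicGroupData.borelSpaceQuotientForm 𝒢
  haveI := AdelicGroupData.smulInvariantMeasureQuotientForm 𝒢 μ
  haveI := AdelicGroupData.isFiniteMeasureOnCompactsQuotientForm 𝒢 μ
  have hψm' : Measurable fun x : 𝒢.automorphicQuotient => conj (ψ x) := Complex.continuous_conj.measurable.comp hψm
  have hfin' : ∫⁻ x, (∑' q : 𝒢.quotientSubgroup ⧸ (𝔓.radical i).subgroupOf 𝒢.quotientSubgroup,
      ‖Φ ((Quotient.out x : 𝒢.Adelic) * ((q.out : 𝒢.quotientSubgroup) : 𝒢.Adelic))‖ₑ) * ‖conj (ψ x)‖ₑ ∂μ < ∞ := by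
    refine lt_of_le_of_lt (le_of_eq (lintegral_congr fun x => ?_)) hfin
    rw [← ofReal_norm (conj (ψ x)), Complex.norm_conj, ofReal_norm]
  obtain ⟨-, h⟩ := adelic_integrable_and_integral_pseudoEisenstein_mul_eq 𝒢 hQ 𝔓 i μ μN haar νN hΦm hΦ hψm' h𝓕 hfin'
  -- the constant terms of `conj ψ` vanish a.e.
  have hCT' : (fun y : 𝒢.Adelic ⧸ 𝔓.radical i => Φ y.out * ∫ u in 𝓕, conj (ψ (𝒢.toAutomorphicQuotient (y.out * (u : 𝒢.Adelic)⁻¹))) ∂νN) =ᵐ[μN] fun _ => 0 := by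
    filter_upwards [hCT] with y hy
    rw [integral_conj, hy, map_zero, mul_zero]
  rw [integral_congr_ae hCT', integral_zero, mul_zero] at h
  have hc : (unfoldingConstant (𝔓.radical i) νN μN (haar : Measure 𝒢.Adelic) : ℝ) ≠ 0 :=
    NNReal.coe_ne_zero.2 (unfoldingConstant_pos_of_ne_zero 𝒢.quotientSubgroup (𝔓.radical i) μ μN haar νN
      (AdelicGroupData.IsAutomorphicMeasure.ne_zero 𝒢 μ) hμN).2.ne'
  exact (mul_eq_zero.1 h).resolve_left (by exact_mod_cast hc)

include hQ μN in
/-- **THE `L²` FORM: `⟪[θ_Φ], v⟫ = 0`** for an `L²` class `v` whose (representative's) constant terms along `N_i` vanish `μ_N`-a.e., and every `Φ` of the square-integrable test class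
`𝒯_i` (`∫⁻ θ_{‖Φ‖}² dμ < ∞`; Hölder ★ `lintegral_tsum_enorm_mul_enorm_lt_top`). [cite: MoeglinWaldspurger1995, II.1.3] [cite: BorelJacquet1979, §4.6] -/
theorem inner_toLp_pseudoEisenstein_eq_zero_of_ae_setIntegral_eq_zero {Φ : 𝒢.Adelic → ℂ} (hΦm : Measurable Φ)
    (hΦ : ∀ (g : 𝒢.Adelic) (n : 𝔓.radical i), Φ (g * n) = Φ g)
    (h2 : ∫⁻ x, (∑' q : 𝒢.quotientSubgroup ⧸ (𝔓.radical i).subgroupOf 𝒢.quotientSubgroup,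
        ‖Φ ((Quotient.out x : 𝒢.Adelic) * ((q.out : 𝒢.quotientSubgroup) : 𝒢.Adelic))‖ₑ) ^ 2 ∂μ < ∞)
    {𝓕 : Set (𝔓.radical i)} (h𝓕 : IsFundamentalDomain (𝔓.rational i) 𝓕 νN) (hμN : μN ≠ 0) (v : 𝒢.L2 μ)
    (hCT : ∀ᵐ y ∂μN, ∫ u in 𝓕, (v : 𝒢.automorphicQuotient → ℂ) (𝒢.toAutomorphicQuotient (y.out * (u : 𝒢.Adelic)⁻¹)) ∂νN = 0) :
    ⟪(memLp_two_pseudoEisenstein_automorphicQuotient 𝒢 𝔓 i μ hΦm hΦ h2).toLp _, v⟫_ℂ = 0 := by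
  letI := AdelicGroupData.measurableSpaceQuotientForm 𝒢
  haveI := AdelicGroupData.borelSpaceQuotientForm 𝒢
  haveI := AdelicGroupData.smulInvariantMeasureQuotientForm 𝒢 μ
  haveI := AdelicGroupData.isFiniteMeasureOnCompactsQuotientForm 𝒢 μ
  have hvm : Measurable (v : 𝒢.automorphicQuotient → ℂ) := (Lp.stronglyMeasurable v).measurable
  have hfin := lintegral_tsum_enorm_mul_enorm_lt_top 𝒢.quotientSubgroup (𝔓.radical i) μ hΦm hΦ h2 (Lp.memLp v)
  have h0 := integral_pseudoEisenstein_mul_conj_eq_zero_of_ae_setIntegral_eq_zero 𝒢 hQ 𝔓 i μ μN νN hΦm hΦ hvm h𝓕 hμN hfin hCT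
  rw [MeasureTheory.L2.inner_def]
  have hae : (fun x : 𝒢.automorphicQuotient => ⟪((memLp_two_pseudoEisenstein_automorphicQuotient 𝒢 𝔓 i μ hΦm hΦ h2).toLp _ : 𝒢.automorphicQuotient → ℂ) x,
      (v : 𝒢.automorphicQuotient → ℂ) x⟫_ℂ) =ᵐ[μ] fun x => conj ((∑' q : 𝒢.quotientSubgroup ⧸ (𝔓.radical i).subgroupOf 𝒢.quotientSubgroup,
        Φ ((Quotient.out x : 𝒢.Adelic) * ((q.out : 𝒢.quotientSubgroup) : 𝒢.Adelic))) * conj ((v : 𝒢.automorphicQuotient → ℂ) x)) := by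
    filter_upwards [(memLp_two_pseudoEisenstein_automorphicQuotient 𝒢 𝔓 i μ hΦm hΦ h2).coeFn_toLp] with x hx
    rw [hx, RCLike.inner_apply', map_mul, starRingEnd_self_apply]
  rw [integral_congr_ae hae, integral_conj, h0, map_zero]

end Adelic

section Assembly

variable {K : Type} [Field K] [NumberField K] (𝒢 : AdelicGroupData K)
  [MeasurableSpace 𝒢.Adelic] [BorelSpace 𝒢.Adelic] [LocallyCompactSpace 𝒢.Adelic] [SecondCountableTopology 𝒢.Adelic] [T2Space 𝒢.Adelic]
  [DiscreteTopology 𝒢.quotientSubgroup] (hQ : 𝒢.quotientSubgroup = 𝒢.arithmeticSubgroup)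
  (𝔓 : 𝒢.ParabolicUnipotentData) [hN : ∀ i : 𝔓.ι, IsClosed ((𝔓.radical i : Subgroup 𝒢.Adelic) : Set 𝒢.Adelic)]
  (μ : Measure 𝒢.automorphicQuotient) [𝒢.IsAutomorphicMeasure μ]
  [∀ i : 𝔓.ι, MeasurableSpace (𝒢.Adelic ⧸ 𝔓.radical i)] [∀ i : 𝔓.ι, BorelSpace (𝒢.Adelic ⧸ 𝔓.radical i)]
  (μN : ∀ i : 𝔓.ι, Measure (𝒢.Adelic ⧸ 𝔓.radical i)) [∀ i : 𝔓.ι, SMulInvariantMeasure 𝒢.Adelic (𝒢.Adelic ⧸ 𝔓.radical i) (μN i)]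
  [∀ i : 𝔓.ι, IsFiniteMeasureOnCompacts (μN i)] [∀ i : 𝔓.ι, (μN i).IsOpenPosMeasure]
  (νN : ∀ i : 𝔓.ι, Measure (𝔓.radical i)) [∀ i : 𝔓.ι, IsHaarMeasure (νN i)] [∀ i : 𝔓.ι, SFinite (νN i)] [∀ i : 𝔓.ι, (νN i).IsInvInvariant]

include hQ μN νN in
/-- **AN `L²` CLASS WHOSE CONSTANT TERMS VANISH ALMOST EVERYWHERE ALONG EVERY RADICAL IS CUSPIDAL** (generic; radical data as ★ (H2)-f: `N_i(𝔸)` closed, `N_i(K)` co-compact, invariant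
`μ_N` finite on compacts and positive on opens, inversion-invariant Haar `ν_N` with a fundamental domain, `A_G = 1`): §1 at every radical, then ★ (H2)-f
`mem_cuspidalSubspace_of_forall_inner_pseudoEisenstein_eq_zero_of_cocompact` (density of the square-integrable pseudo-Eisenstein classes in `(L²_cusp)ᗮ`).
[cite: MoeglinWaldspurger1995, II.1.2–II.1.4] [cite: Garrett2018, §1.8] -/
theorem mem_cuspidalSubspace_of_ae_setIntegral_eq_zero
    (hcpt : ∀ i : 𝔓.ι, ∃ C : Set (𝔓.radical i), IsCompact C ∧ ∀ u : 𝔓.radical i, ∃ l : 𝔓.rational i, l • u ∈ C)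
    {𝓕 : ∀ i : 𝔓.ι, Set (𝔓.radical i)} (h𝓕 : ∀ i, IsFundamentalDomain (𝔓.rational i) (𝓕 i) (νN i)) (v : 𝒢.L2 μ)
    (hCT : ∀ i : 𝔓.ι, ∀ᵐ y ∂(μN i), ∫ u in 𝓕 i, (v : 𝒢.automorphicQuotient → ℂ) (𝒢.toAutomorphicQuotient (y.out * (u : 𝒢.Adelic)⁻¹)) ∂(νN i) = 0) :
    v ∈ 𝒢.cuspidalSubspace μ 𝔓 := by
  have hμN0 : ∀ i, μN i ≠ 0 := fun i h0 => by
    have := (isOpen_univ.measure_pos (μN i) ⟨QuotientGroup.mk 1, trivial⟩).ne'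
    rw [h0, Measure.coe_zero, Pi.zero_apply] at this
    exact this rfl
  exact mem_cuspidalSubspace_of_forall_inner_pseudoEisenstein_eq_zero_of_cocompact 𝒢 hQ 𝔓 μ μN νN hcpt fun i Φ hΦm hΦ h2 =>
    inner_toLp_pseudoEisenstein_eq_zero_of_ae_setIntegral_eq_zero 𝒢 hQ 𝔓 i μ (μN i) (νN i) hΦm hΦ h2 (h𝓕 i) (hμN0 i) v (hCT i)

end Assembly

/-! ## §2 The `U(Φ₃)` print: every radical datum discharged -/

section CMThree

variable (L : Type) [Field L] [NumberField L] [IsCMField L]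
variable [MeasurableSpace (cmDatum L 3 (Matrix.of fun i j : Fin 3 => if i.val + j.val + 1 = 3 then (1 : L) else 0)).Adelic]
  [BorelSpace (cmDatum L 3 (Matrix.of fun i j : Fin 3 => if i.val + j.val + 1 = 3 then (1 : L) else 0)).Adelic]
  (μ : Measure (cmDatum L 3 (Matrix.of fun i j : Fin 3 => if i.val + j.val + 1 = 3 then (1 : L) else 0)).automorphicQuotient)
  [(cmDatum L 3 (Matrix.of fun i j : Fin 3 => if i.val + j.val + 1 = 3 then (1 : L) else 0)).IsAutomorphicMeasure μ]

/-- **`U(Φ₃)`: AN `L²` CLASS WITH VANISHING CONSTANT TERMS ALONG THE HEISENBERG RADICAL IS CUSPIDAL — `v ∈ cmCuspidalSubspaceR L 3 μ`.**  Hypothesis, in the trunk's «for all data» a.e.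
form: for every index `i` of ★ `cmParabolicDataR L 3`, every Borel structure making the quotient `G(𝔸)∕N_i(𝔸)` a Borel space, every Haar measure `ν_N` on `N_i(𝔸)` with a fundamental
domain `𝓕` of `N_i(L⁺)`, and every `G(𝔸)`-invariant measure `μ_N` on `G(𝔸)∕N_i(𝔸)`, the constant terms `∫_𝓕 v([ỹ u⁻¹]) dν_N(u)` of (the representative of) `v` vanish for `μ_N`-a.e. `ỹ`.
All radical data (closed, unimodular, co-compact Heisenberg radical ★; Weil's invariant `μ_N` ★ `exists_invariantMeasure_quotient_cmParabolicDataR_three`; fundamental domains ★; `A_G = 1` ★)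
are discharged exactly as in ★ `cmCuspidalSubspaceR_orthogonal_eq_topologicalClosure_span_three`.  This is the door through which ★ p859418's letter `hcusp` is paid from the continued
constant-term identity. [cite: MoeglinWaldspurger1995, II.1.2–II.1.4] [cite: BorelJacquet1979, §4.4–§4.6] -/
theorem mem_cmCuspidalSubspaceR_three_of_ae_constantTerm_eq_zero
    (v : (cmDatum L 3 (Matrix.of fun i j : Fin 3 => if i.val + j.val + 1 = 3 then (1 : L) else 0)).L2 μ)
    (hCT : ∀ (i : (cmParabolicDataR L 3).ι)
      [MeasurableSpace ((cmDatum L 3 (Matrix.of fun i j : Fin 3 => if i.val + j.val + 1 = 3 then (1 : L) else 0)).Adelic ⧸ (cmParabolicDataR L 3).radical i)]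
      [BorelSpace ((cmDatum L 3 (Matrix.of fun i j : Fin 3 => if i.val + j.val + 1 = 3 then (1 : L) else 0)).Adelic ⧸ (cmParabolicDataR L 3).radical i)]
      (νN : Measure ((cmParabolicDataR L 3).radical i)) [IsHaarMeasure νN]
      (𝓕 : Set ((cmParabolicDataR L 3).radical i)), IsFundamentalDomain ((cmParabolicDataR L 3).rational i) 𝓕 νN →
      ∀ (μN : Measure ((cmDatum L 3 (Matrix.of fun i j : Fin 3 => if i.val + j.val + 1 = 3 then (1 : L) else 0)).Adelic ⧸ (cmParabolicDataR L 3).radical i))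
        [SMulInvariantMeasure (cmDatum L 3 (Matrix.of fun i j : Fin 3 => if i.val + j.val + 1 = 3 then (1 : L) else 0)).Adelic
          ((cmDatum L 3 (Matrix.of fun i j : Fin 3 => if i.val + j.val + 1 = 3 then (1 : L) else 0)).Adelic ⧸ (cmParabolicDataR L 3).radical i) μN],
        ∀ᵐ y ∂μN, ∫ u in 𝓕, (v : (cmDatum L 3 (Matrix.of fun i j : Fin 3 => if i.val + j.val + 1 = 3 then (1 : L) else 0)).automorphicQuotient → ℂ)
          ((cmDatum L 3 (Matrix.of fun i j : Fin 3 => if i.val + j.val + 1 = 3 then (1 : L) else 0)).toAutomorphicQuotient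
            (y.out * (u : (cmDatum L 3 (Matrix.of fun i j : Fin 3 => if i.val + j.val + 1 = 3 then (1 : L) else 0)).Adelic)⁻¹)) ∂νN = 0) :
    v ∈ cmCuspidalSubspaceR L 3 μ := by
  haveI := discreteTopology_cmDatum_quotientSubgroup L 3 (Matrix.of fun i j : Fin 3 => if i.val + j.val + 1 = 3 then (1 : L) else 0)
  haveI : ∀ i, IsClosed (((cmParabolicDataR L 3).radical i : Subgroup (cmDatum L 3 (Matrix.of fun i j : Fin 3 => if i.val + j.val + 1 = 3 then (1 : L) else 0)).Adelic) :
      Set (cmDatum L 3 (Matrix.of fun i j : Fin 3 => if i.val + j.val + 1 = 3 then (1 : L) else 0)).Adelic) := fun i => isClosed_cmParabolicDataR_radical_three L i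
  haveI : ∀ i, LocallyCompactSpace ((cmParabolicDataR L 3).radical i) := fun i => (isClosed_cmParabolicDataR_radical_three L i).locallyCompactSpace
  haveI : ∀ i, SecondCountableTopology ((cmParabolicDataR L 3).radical i) := fun i => TopologicalSpace.Subtype.secondCountableTopology _
  letI : ∀ i, MeasurableSpace ((cmDatum L 3 (Matrix.of fun i j : Fin 3 => if i.val + j.val + 1 = 3 then (1 : L) else 0)).Adelic ⧸ (cmParabolicDataR L 3).radical i) := fun i => borel _
  haveI : ∀ i, BorelSpace ((cmDatum L 3 (Matrix.of fun i j : Fin 3 => if i.val + j.val + 1 = 3 then (1 : L) else 0)).Adelic ⧸ (cmParabolicDataR L 3).radical i) := fun i => ⟨rfl⟩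
  have hμN := fun i => exists_invariantMeasure_quotient_cmParabolicDataR_three L i
  choose μN hμN hμNc hμNo using hμN
  haveI := hμN; haveI := hμNc; haveI := hμNo
  obtain ⟨νN, hνN⟩ : ∃ νN : ∀ i, Measure ((cmParabolicDataR L 3).radical i), ∀ i, IsHaarMeasure (νN i) ∧ (νN i).IsInvInvariant :=
    ⟨fun i => haar, fun i => ⟨inferInstance, isInvInvariant_cmParabolicDataR_three L i haar⟩⟩
  haveI : ∀ i, IsHaarMeasure (νN i) := fun i => (hνN i).1
  haveI : ∀ i, (νN i).IsInvInvariant := fun i => (hνN i).2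
  haveI : ∀ i, SigmaFinite (νN i) := fun i => by infer_instance
  have hcpt : ∀ i : (cmParabolicDataR L 3).ι, ∃ C : Set ((cmParabolicDataR L 3).radical i), IsCompact C ∧ ∀ u : (cmParabolicDataR L 3).radical i, ∃ l : (cmParabolicDataR L 3).rational i, l • u ∈ C := by
    intro i
    obtain ⟨k, hk⟩ := i
    obtain rfl : k = 1 := by omega
    exact exists_isCompact_rational_smul_mem_heisenberg L (antidiagOne_eq_over (L := L) (N := 3)).symm
  have h𝓕 := fun i => exists_isFundamentalDomain_cmParabolicDataR_three L i (νN i)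
  choose 𝓕 h𝓕 _h𝓕 using h𝓕
  have hQ : (cmDatum L 3 (Matrix.of fun i j : Fin 3 => if i.val + j.val + 1 = 3 then (1 : L) else 0)).quotientSubgroup =
      (cmDatum L 3 (Matrix.of fun i j : Fin 3 => if i.val + j.val + 1 = 3 then (1 : L) else 0)).arithmeticSubgroup :=
    (cmDatum_quotientSubgroup L 3 _).trans (cmDatum_arithmeticSubgroup L 3 _).symm
  exact mem_cuspidalSubspace_of_ae_setIntegral_eq_zero _ hQ (cmParabolicDataR L 3) μ μN νN hcpt h𝓕 v fun i => hCT i (νN i) (𝓕 i) (h𝓕 i) (μN i)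

end CMThree

end Summit.HodgeConjecture.HodgeConjecture.Cruxes.H413.K2E1ContinuedZeroConstantTermOrthogonalCMThree

end
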